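import Summits.CriticalPhenomena.SAWScalingLimit.Theses.SAWRestrictionRigidity
import Literature.Probability.RandomPlanarGeometry.LatticeSimilarityCovariance
import Literature.Probability.RandomPlanarGeometry.ConformalRestrictionProofs
import HarnessLib

/-!
# Transport of conformal covariance through a complex-(anti)linear modulus

Stub `stub_covarianceTransport` (3b) of line `registered` for the crux `Rigidity`
(stmt-CriticalPhenomena-1368, route SAWRestrictionRigidity; skeleton
`Summits/CriticalPhenomena/SAWScalingLimit/Cruxes/Rigidity/Lines/registered.lean`).

If a chordal family `S` is the transport `S D = (L⁻¹)_* P (L D)` of a chordal family `P` through a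
real-linear automorphism `L : ℂ ≃L[ℝ] ℂ` of the plane, `S` is conformally covariant
(`ChordalFamily.IsConformallyCovariant`, Werner 2007 §3.2 (1) / LSW 2004 §2) and `L` is
complex-linear (`L z = c z`) or complex-antilinear (`L z = c z̄`), then `P` is conformally
covariant. Proof: `P D = L_* S (L⁻¹ D)` (functoriality of `MarkedDomain.map` and `CurveClass.map`);
a conformal equivalence `g : D → D'` with boundary values `a ↦ a'`, `b ↦ b'` conjugates to the
conformal equivalence `L⁻¹ ∘ g ∘ L : L⁻¹ D → L⁻¹ D'` (a similarity conjugate `z ↦ c⁻¹ g (c z)`,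
resp. `z ↦ conj (c⁻¹ g (c conj z))`, holomorphic by `differentiableAt_conj_conj_iff`), its boundary
values transport along the homeomorphism `L⁻¹`, and the test map `Φ' = L⁻¹ ∘ Φ ∘ L` agrees with it
on `L⁻¹ D`; conformal covariance of `S` there pushes forward along `L` to `P D' = Φ_* (P D)`
(`Measure.map_map`).

References: W. Werner, *Lectures on two-dimensional critical percolation* (2007), §3.2 (1);
G. F. Lawler, O. Schramm, W. Werner, *On the scaling limit of planar self-avoiding walk* (2004), §2;
V. Beffara, *Is critical 2D percolation universal?* (2008), Prop. 4.
-/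

noncomputable section

open Set Filter Topology MeasureTheory
open scoped ComplexConjugate
open Literature.Probability.RandomPlanarGeometry

namespace Summit.CriticalPhenomena.SAWScalingLimit.Cruxes.Rigidity.Birth

/-- Holomorphy is preserved under conjugation `f ↦ L⁻¹ ∘ f ∘ L` by a real-linear automorphism `L`
of the plane which is complex-linear (`L z = c z`) or complex-antilinear (`L z = c z̄`): on
`L⁻¹ U = L⁻¹ '' U` the conjugate is `z ↦ c⁻¹ f (c z)`, resp. `z ↦ conj (c⁻¹ f (c conj z))`, and
`conj ∘ h ∘ conj` is holomorphic where `h` is (`differentiableAt_conj_conj_iff`; `U` open).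
[folklore] -/
private theorem differentiableOn_linearConjugate {L : ℂ ≃L[ℝ] ℂ}
    (hL : (∃ c : ℂ, ∀ z : ℂ, L z = c * z) ∨ (∃ c : ℂ, ∀ z : ℂ, L z = c * (starRingEnd ℂ) z))
    {U : Set ℂ} (hU : IsOpen U) {f : ℂ → ℂ} (hf : DifferentiableOn ℂ f U) :
    DifferentiableOn ℂ (fun z => L.symm.toHomeomorph (f (L.symm.toHomeomorph.symm z)))
      (L.symm.toHomeomorph '' U) := by
  rw [Homeomorph.image_eq_preimage_symm]
  change DifferentiableOn ℂ (fun z => L.symm (f (L z))) (L ⁻¹' U)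
  rcases hL with ⟨c, hc⟩ | ⟨c, hc⟩
  · -- complex-linear case: `L z = c z`, `L⁻¹ w = c⁻¹ w`
    have hc0 : c ≠ 0 := by
      intro h0
      have h1 : L 1 = L 0 := by rw [hc, hc, h0, zero_mul, zero_mul]
      exact one_ne_zero (L.injective h1)
    have hsymm : ∀ w, L.symm w = c⁻¹ * w := fun w =>
      L.injective (by rw [L.apply_symm_apply, hc, mul_inv_cancel_left₀ hc0])
    have hfun : (fun z => L.symm (f (L z))) = fun z => c⁻¹ * f (c * z) := by
      funext z
      rw [hsymm, hc]
    rw [hfun]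
    refine DifferentiableOn.const_mul (hf.comp ?_ ?_) c⁻¹
    · fun_prop
    · intro z hz
      rw [mem_preimage, hc] at hz
      exact hz
  · -- complex-antilinear case: `L z = c conj z`, `L⁻¹ w = conj (c⁻¹ w)`
    have hc0 : c ≠ 0 := by
      intro h0
      have h1 : L 1 = L 0 := by rw [hc, hc, h0, zero_mul, zero_mul]
      exact one_ne_zero (L.injective h1)
    have hsymm : ∀ w, L.symm w = conj (c⁻¹ * w) := fun w =>
      L.injective (by rw [L.apply_symm_apply, hc, Complex.conj_conj, mul_inv_cancel_left₀ hc0])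
    have hfun : (fun z => L.symm (f (L z))) = conj ∘ (fun w => c⁻¹ * f (c * w)) ∘ conj := by
      funext z
      rw [Function.comp_apply, Function.comp_apply, hsymm, hc]
    rw [hfun]
    intro z hz
    have hz' : c * conj z ∈ U := by
      rw [mem_preimage, hc] at hz
      exact hz
    have hfd : DifferentiableAt ℂ f (c * conj z) := (hf _ hz').differentiableAt (hU.mem_nhds hz')
    refine (differentiableAt_conj_conj_iff.2 ?_).differentiableWithinAt
    have hmul : DifferentiableAt ℂ (fun w : ℂ => c * w) (conj z) := by fun_prop
    exact (hfd.comp (conj z) hmul).const_mul c⁻¹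

/-- **Stub 3b (`stub_covarianceTransport`): transport of conformal covariance through a
complex-(anti)linear modulus.** If `S D = (L⁻¹)_* P (L D)` for all Dobrushin domains `D`, `S` is
conformally covariant and `L` is complex-linear (`L = c •`) or complex-antilinear (`L = c conj •`),
then `P` is conformally covariant: `P D = L_* S (L⁻¹ D)`; a conformal equivalence `g : D → D'`
with boundary values `a ↦ a'`, `b ↦ b'` conjugates to the conformal equivalence
`L⁻¹ ∘ g ∘ L : L⁻¹ D → L⁻¹ D'` with the transported boundary values, the test map
`Φ' = L⁻¹ ∘ Φ ∘ L` agrees with it on `L⁻¹ D`, and conformal covariance of `S` pushes forward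
along `L` to `P D' = Φ_* (P D)`. [cite: Werner2007, §3.2 (1)] -/
theorem stub_covarianceTransport : ∀ (P S : Literature.Probability.RandomPlanarGeometry.ChordalFamily) (L : ℂ ≃L[ℝ] ℂ), (∀ D : Literature.Probability.RandomPlanarGeometry.DobrushinDomain, S D = (P (D.map L.toHomeomorph)).map (Literature.Probability.RandomPlanarGeometry.CurveClass.map (L.symm.toHomeomorph : C(ℂ, ℂ)))) → S.IsConformallyCovariant → ((∃ c : ℂ, ∀ z : ℂ, L z = c * z) ∨ (∃ c : ℂ, ∀ z : ℂ, L z = c * (starRingEnd ℂ) z)) → P.IsConformallyCovariant := by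
  intro P S L hS hScc hL
  -- Functoriality: `L⁻¹` followed by `L` is the identity, on marked domains and on curve laws.
  have htrans : L.symm.toHomeomorph.trans L.toHomeomorph = Homeomorph.refl ℂ :=
    Homeomorph.ext fun z => L.apply_symm_apply z
  have hrefl : ∀ D : DobrushinDomain, D.map (Homeomorph.refl ℂ) = D := fun D =>
    MarkedDomain.ext (JordanDomain.ext (by simp) rfl) rfl
  have hback : ∀ D : DobrushinDomain, (D.map L.symm.toHomeomorph).map L.toHomeomorph = D :=
    fun D => by rw [MarkedDomain.map_map, htrans, hrefl]
  have hcomp : (L.toHomeomorph : C(ℂ, ℂ)).comp (L.symm.toHomeomorph : C(ℂ, ℂ)) =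
      ContinuousMap.id ℂ :=
    ContinuousMap.ext fun z => L.apply_symm_apply z
  have hmaps : CurveClass.map (L.toHomeomorph : C(ℂ, ℂ)) ∘
      CurveClass.map (L.symm.toHomeomorph : C(ℂ, ℂ)) = id := by
    funext c
    rw [Function.comp_apply, CurveClass.map_map, hcomp, CurveClass.map_id, id]
  -- Step 1: `P D = L_* S (L⁻¹ D)`.
  have hP : ∀ D : DobrushinDomain, P D =
      (S (D.map L.symm.toHomeomorph)).map (CurveClass.map (L.toHomeomorph : C(ℂ, ℂ))) := by
    intro D
    rw [hS (D.map L.symm.toHomeomorph), hback,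
      Measure.map_map (CurveClass.measurable_map _) (CurveClass.measurable_map _), hmaps,
      Measure.map_id]
  -- Step 2: conjugate the data of conformal covariance by `L⁻¹`.
  intro D D' g Φ h0 h1 hΦg
  set ψ : ℂ ≃ₜ ℂ := L.symm.toHomeomorph with hψ
  -- the conjugated conformal equivalence `ψ ∘ g ∘ ψ⁻¹ : ψ D → ψ D'`
  obtain ⟨g', hg'⟩ : ∃ g' : ConformalEquiv (D.map ψ).carrier (D'.map ψ).carrier,
      ∀ z, g' z = ψ (g (ψ.symm z)) :=
    ⟨{ toFun := fun z => ψ (g (ψ.symm z))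
       invFun := fun z => ψ (g.symm (ψ.symm z))
       source := ψ '' D.carrier
       target := ψ '' D'.carrier
       map_source' := by
         rintro _ ⟨x, hx, rfl⟩
         rw [ψ.symm_apply_apply]
         exact mem_image_of_mem ψ (g.mapsTo hx)
       map_target' := by
         rintro _ ⟨x, hx, rfl⟩
         rw [ψ.symm_apply_apply]
         exact mem_image_of_mem ψ (g.symm_mapsTo hx)
       left_inv' := by
         rintro _ ⟨x, hx, rfl⟩
         rw [ψ.symm_apply_apply, ψ.symm_apply_apply, g.symm_apply_apply hx]
       right_inv' := by
         rintro _ ⟨x, hx, rfl⟩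
         rw [ψ.symm_apply_apply, ψ.symm_apply_apply, g.apply_symm_apply hx]
       source_eq := rfl
       target_eq := rfl
       differentiableOn := by
         rw [hψ]
         exact differentiableOn_linearConjugate hL D.isOpen g.differentiableOn
       differentiableOn_symm := by
         rw [hψ]
         exact differentiableOn_linearConjugate hL D'.isOpen g.symm.differentiableOn },
      fun z => rfl⟩
  have hg'fun : (g' : ℂ → ℂ) = ψ ∘ g ∘ ψ.symm := funext hg'
  -- boundary values transport along `ψ`
  have hψin : ∀ x : ℂ, Tendsto ψ.symm (𝓝[ψ '' D.carrier] (ψ x)) (𝓝[D.carrier] x) := by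
    intro x
    have hc : ContinuousWithinAt ψ.symm (ψ '' D.carrier) (ψ x) :=
      ψ.symm.continuous.continuousWithinAt
    have h := hc.tendsto_nhdsWithin (by
      rintro _ ⟨y, hy, rfl⟩
      rw [ψ.symm_apply_apply]
      exact hy)
    rwa [ψ.symm_apply_apply] at h
  have hbv : ∀ i : Fin 2, g.HasBoundaryValue (D.pt i) (D'.pt i) →
      g'.HasBoundaryValue ((D.map ψ).pt i) ((D'.map ψ).pt i) := by
    intro i h
    unfold ConformalEquiv.HasBoundaryValue at h ⊢
    rw [hg'fun, MarkedDomain.pt_map, MarkedDomain.pt_map, MarkedDomain.carrier_map]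
    exact (ψ.continuous.tendsto _).comp (h.comp (hψin _))
  -- the conjugated test map `ψ ∘ Φ ∘ ψ⁻¹`
  set Φ' : C(ℂ, ℂ) := (ψ : C(ℂ, ℂ)).comp (Φ.comp (ψ.symm : C(ℂ, ℂ))) with hΦ'
  have hEq : Set.EqOn Φ' g' (D.map ψ).carrier := by
    rintro _ ⟨x, hx, rfl⟩
    rw [hg']
    change ψ (Φ (ψ.symm (ψ x))) = ψ (g (ψ.symm (ψ x)))
    rw [ψ.symm_apply_apply, hΦg hx]
  -- Step 3: conformal covariance of `S` between `ψ D` and `ψ D'`, pushed forward along `L`.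
  have key := hScc (D.map ψ) (D'.map ψ) g' Φ' (hbv 0 h0) (hbv 1 h1) hEq
  have hΦcomp : (L.toHomeomorph : C(ℂ, ℂ)).comp Φ' = Φ.comp (L.toHomeomorph : C(ℂ, ℂ)) := by
    ext1 z
    change L (L.symm (Φ (L.symm.toHomeomorph.symm z))) = Φ (L z)
    rw [L.apply_symm_apply]
    rfl
  rw [hP D', hP D, key, Measure.map_map (CurveClass.measurable_map _) (CurveClass.measurable_map _),
    Measure.map_map (CurveClass.measurable_map _) (CurveClass.measurable_map _)]
  congr 1
  funext c
  rw [Function.comp_apply, Function.comp_apply, CurveClass.map_map, CurveClass.map_map, hΦcomp]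

end Summit.CriticalPhenomena.SAWScalingLimit.Cruxes.Rigidity.Birth

end
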